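import Summits.ValiantsHypothesis.ValiantsHypothesis.Theorems.LacunarySymmetroidMatrixDescartesDoorA26WallBubblingMixTop

/-!
# Wall bubbling for `DoorA26` — THE MIXED-CLASS TOP RULE OVER ABSTRACT FRAMES (for the three-pair chain)

HONEST FRAMING.  Obligation (W) `stub_weylFaces` of `Cruxes/DoorA26/Lines/wall_bubbling.lean` (crux `DoorA26`, stmt-ValiantsHypothesis-19979; OPEN,
typed, never asserted); W1 seat val-sym-door-p2 g14.  W1 #54 `mixTop_face` (= `MixTop26` of rev 8/9 of `Lines/wall_bubbling_ConfluentDoor.lean`) is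
stated on the TWO-PAIR frames (if-chains with special positions `0,1,4,5`).  The three-pair chain (`ValueGenericThreePairChain26`, OPEN) needs the
same rule for the mixed classes `δ₀+δ₁`, `δ₀+δ₂`, `δ₁+δ₂` of the THREE-PAIR frame.  Since the one-stage lemma W1 `mixTop_stage` never reads the frame
at positions `2, 3`, the rule holds for ANY frames `F, F' : ℕ → Fin 6 → M₂(ℝ)` whose entries at positions `0, 5, 1, 4` are the two-dslope
letters of `U` at the two scales — whatever they are elsewhere:

* **`mixTop_frames`** — frame equations `hF0 … hF'4`, dominations / Gram-normalised limits for `polar (F ν a) (F ν b)`, `polar (F' ν a) (F' ν b)`;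
  conclusion `Γ 5 4 ≠ 0 → Γ' 5 4 = 0 ∧ Γ' 0 4 = 0 ∧ Γ' 5 1 = 0`.  No symmetry, no value-genericity (as for the two-pair statement).

Three-pair instances: relabel the letters (`U ∘ σ`, `δs ∘ σ`) so the class sits at `(0,5),(1,4)` and discharge the frame equations by `simp`
(port memo `HOME/val-sym-door-p2/g14/THREE-PAIR-CHAIN-PORT.md`).  Proof = W1 #54's with the if-chain evaluations replaced by the frame equations.
Registers unchanged; (W), `ValueGenericThreePairChain26`, `DoorA26` 19979, 18050 OPEN; nothing on VP ≠ VNP.  Def-free.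
`--supports stmt-ValiantsHypothesis-19979 --as helper`.
-/

-- `Summit.ValiantsHypothesis.ValiantsHypothesis.…` repeats a component by the D-0017 layout
-- (single-conjunct summit), which the `dupNamespace` linter flags; the name is mandated.
set_option linter.dupNamespace false

namespace Summit.ValiantsHypothesis.ValiantsHypothesis.Theorems.LacunarySymmetroidMatrixDescartes.WallBubbling

open Finset Filter Topology
open Bubbling (polar)
open scoped BigOperators

/-- **TOP RULE OVER ABSTRACT FRAMES** (see the module docstring). [this work] -/
theorem mixTop_frames (δ0 : Fin 6 → ℝ) (h50 : δ0 5 = δ0 0) (h41 : δ0 4 = δ0 1)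
    (δs : ℕ → Fin 6 → ℝ) (hδ : ∀ l, Tendsto (fun ν => δs ν l) atTop (𝓝 (δ0 l)))
    (U : ℕ → Fin 6 → Matrix (Fin 2) (Fin 2) ℝ) (F F' : ℕ → Fin 6 → Matrix (Fin 2) (Fin 2) ℝ) (L : ℕ → ℝ) (hL : Tendsto L atTop atTop)
    (hF0 : ∀ ν, F ν 0 = U ν 0 + U ν 5) (hF5 : ∀ ν, F ν 5 = (δs ν 5 - δs ν 0) • U ν 5)
    (hF1 : ∀ ν, F ν 1 = U ν 1 + U ν 4) (hF4 : ∀ ν, F ν 4 = (δs ν 4 - δs ν 1) • U ν 4)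
    (hF'0 : ∀ ν, F' ν 0 = Real.exp (δs ν 0 * L ν) • U ν 0 + Real.exp (δs ν 5 * L ν) • U ν 5)
    (hF'5 : ∀ ν, F' ν 5 = (δs ν 5 - δs ν 0) • (Real.exp (δs ν 5 * L ν) • U ν 5))
    (hF'1 : ∀ ν, F' ν 1 = Real.exp (δs ν 1 * L ν) • U ν 1 + Real.exp (δs ν 4 * L ν) • U ν 4)
    (hF'4 : ∀ ν, F' ν 4 = (δs ν 4 - δs ν 1) • (Real.exp (δs ν 4 * L ν) • U ν 4))
    (μ μ' : ℕ → ℝ) (hμ : ∀ ν, 0 < μ ν) (hμ' : ∀ ν, 0 < μ' ν)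
    (hdom : ∀ ν a b, |polar (F ν a) (F ν b)| ≤ μ ν) (hdom' : ∀ ν a b, |polar (F' ν a) (F' ν b)| ≤ μ' ν)
    (Γ Γ' : Fin 6 → Fin 6 → ℝ)
    (hΓ : ∀ a b, Tendsto (fun ν => polar (F ν a) (F ν b) / μ ν) atTop (𝓝 (Γ a b)))
    (hΓ' : ∀ a b, Tendsto (fun ν => polar (F' ν a) (F' ν b) / μ' ν) atTop (𝓝 (Γ' a b))) :
    Γ 5 4 ≠ 0 → Γ' 5 4 = 0 ∧ Γ' 0 4 = 0 ∧ Γ' 5 1 = 0 := by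
  intro h1
  set κ : ℝ := |Γ 5 4| / 2 with hκ
  have hκpos : 0 < κ := by rw [hκ]; exact half_pos (abs_pos.mpr h1)
  have hw0 : Tendsto (fun ν => δs ν 5 - δs ν 0) atTop (𝓝 0) := by
    have := (hδ 5).sub (hδ 0)
    rw [h50, sub_self] at this
    exact this
  have hw1 : Tendsto (fun ν => δs ν 4 - δs ν 1) atTop (𝓝 0) := by
    have := (hδ 4).sub (hδ 1)
    rw [h41, sub_self] at this
    exact this
  -- upstream: `(5,4)` alive, eventually
  have e1 : ∀ᶠ ν in atTop, κ * μ ν ≤ |polar ((δs ν 5 - δs ν 0) • U ν 5) ((δs ν 4 - δs ν 1) • U ν 4)| := by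
    have h := ((hΓ 5 4).abs).eventually_const_lt (show κ < |Γ 5 4| by rw [hκ]; linarith [abs_pos.mpr h1])
    filter_upwards [h] with ν hν
    rw [hF5 ν, hF4 ν] at hν
    rw [abs_div, abs_of_pos (hμ ν), lt_div_iff₀ (hμ ν)] at hν
    exact hν.le
  -- `|Λ|`, `|Λ'|` eventually exceed `1 + 2/κ`
  have ebΛ : ∀ᶠ ν in atTop, 0 * Real.exp ((δs ν 5 - δs ν 0) * L ν) + (1 + 2 / κ)
      < |dslope (fun y : ℝ => Real.exp (y * L ν)) 0 (δs ν 5 - δs ν 0)| :=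
    eventually_dslope_exp_gt (fun ν => δs ν 5 - δs ν 0) L hw0 hL 0 (1 + 2 / κ) le_rfl (by positivity)
  have ebΛ' : ∀ᶠ ν in atTop, 0 * Real.exp ((δs ν 4 - δs ν 1) * L ν) + (1 + 2 / κ)
      < |dslope (fun y : ℝ => Real.exp (y * L ν)) 0 (δs ν 4 - δs ν 1)| :=
    eventually_dslope_exp_gt (fun ν => δs ν 4 - δs ν 1) L hw1 hL 0 (1 + 2 / κ) le_rfl (by positivity)
  -- the contradiction engine: a downstream alive member of the mixed class (other than `(0,1)`) is impossible
  have engine : ∀ (a' b' : Fin 6), (a' = 5 ∧ b' = 4) ∨ (a' = 0 ∧ b' = 4) ∨ (a' = 5 ∧ b' = 1) → Γ' a' b' ≠ 0 → False := by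
    intro a' b' hab hne
    set κ' : ℝ := |Γ' a' b'| / 2 with hκ'
    have hκ'pos : 0 < κ' := by rw [hκ']; exact half_pos (abs_pos.mpr hne)
    have e2 : ∀ᶠ ν in atTop, κ' * μ' ν ≤ |polar (F' ν a') (F' ν b')| := by
      have h := ((hΓ' a' b').abs).eventually_const_lt (show κ' < |Γ' a' b'| by rw [hκ']; linarith [abs_pos.mpr hne])
      filter_upwards [h] with ν hν
      rw [abs_div, abs_of_pos (hμ' ν), lt_div_iff₀ (hμ' ν)] at hν
      exact hν.le
    have eaΛ : ∀ᶠ ν in atTop, (1 / κ') * Real.exp ((δs ν 5 - δs ν 0) * L ν) + (2 / κ)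
        < |dslope (fun y : ℝ => Real.exp (y * L ν)) 0 (δs ν 5 - δs ν 0)| :=
      eventually_dslope_exp_gt (fun ν => δs ν 5 - δs ν 0) L hw0 hL (1 / κ') (2 / κ) (by positivity) (by positivity)
    have eaΛ' : ∀ᶠ ν in atTop, (1 / κ') * Real.exp ((δs ν 4 - δs ν 1) * L ν) + (2 / κ)
        < |dslope (fun y : ℝ => Real.exp (y * L ν)) 0 (δs ν 4 - δs ν 1)| :=
      eventually_dslope_exp_gt (fun ν => δs ν 4 - δs ν 1) L hw1 hL (1 / κ') (2 / κ) (by positivity) (by positivity)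
    have hfalse : ∀ᶠ ν : ℕ in atTop, False := by
      filter_upwards [e1, e2, ebΛ, ebΛ', eaΛ, eaΛ'] with ν hν1 hν2 hνbΛ hνbΛ' hνaΛ hνaΛ'
      rw [zero_mul, zero_add] at hνbΛ hνbΛ'
      have h04le := hdom ν 0 4
      rw [hF0 ν, hF4 ν] at h04le
      have h51le := hdom ν 5 1
      rw [hF5 ν, hF1 ν] at h51le
      have h01le := hdom ν 0 1
      rw [hF0 ν, hF1 ν] at h01le
      have hdom04 := hdom' ν 0 4
      rw [hF'0 ν, hF'4 ν] at hdom04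
      have hdom01 := hdom' ν 0 1
      rw [hF'0 ν, hF'1 ν] at hdom01
      rcases hab with ⟨rfl, rfl⟩ | ⟨rfl, rfl⟩ | ⟨rfl, rfl⟩
      · rw [hF'5 ν, hF'4 ν] at hν2
        exact mixTop_stage (δs ν) (U ν) (L ν) (μ ν) (μ' ν) κ κ' (hμ ν) (hμ' ν) hκpos hκ'pos hν1 h04le h51le h01le hdom04 hdom01
          hνaΛ hνaΛ' hνbΛ hνbΛ' (Or.inl hν2)
      · rw [hF'0 ν, hF'4 ν] at hν2
        exact mixTop_stage (δs ν) (U ν) (L ν) (μ ν) (μ' ν) κ κ' (hμ ν) (hμ' ν) hκpos hκ'pos hν1 h04le h51le h01le hdom04 hdom01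
          hνaΛ hνaΛ' hνbΛ hνbΛ' (Or.inr (Or.inl hν2))
      · rw [hF'5 ν, hF'1 ν] at hν2
        exact mixTop_stage (δs ν) (U ν) (L ν) (μ ν) (μ' ν) κ κ' (hμ ν) (hμ' ν) hκpos hκ'pos hν1 h04le h51le h01le hdom04 hdom01
          hνaΛ hνaΛ' hνbΛ hνbΛ' (Or.inr (Or.inr hν2))
    exact hfalse.exists.elim fun _ h => h
  refine ⟨?_, ?_, ?_⟩
  · by_contra h; exact engine 5 4 (Or.inl ⟨rfl, rfl⟩) h
  · by_contra h; exact engine 0 4 (Or.inr (Or.inl ⟨rfl, rfl⟩)) h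
  · by_contra h; exact engine 5 1 (Or.inr (Or.inr ⟨rfl, rfl⟩)) h

end Summit.ValiantsHypothesis.ValiantsHypothesis.Theorems.LacunarySymmetroidMatrixDescartes.WallBubbling
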